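import Summits.NavierStokesRegularity.NavierStokesRegularity.Theses.FilamentSkeletonRss
import Summits.NavierStokesRegularity.NavierStokesRegularity.Theorems.FilamentSkeletonRssSkeletonEquilibriumRadialSinkModel
import Summits.NavierStokesRegularity.NavierStokesRegularity.Theorems.FilamentSkeletonRssSkeletonEquilibriumSlopeFormula
import Summits.NavierStokesRegularity.NavierStokesRegularity.Theorems.FilamentSkeletonRssSkeletonEquilibriumTameVerticalSubcritical
import HarnessLib.Audit

/-!
# Line `zero-accretion-selection` — NEGATION skeleton for the crux `FilamentSkeletonRss.SkeletonEquilibrium`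
(crux item stmt-NavierStokesRegularity-15400; lead a1 `prover-line-stmt-NavierStokesRegularity-15400-a1-0`, 2026-08-17;
memo `Lines/zero-accretion-selection-lead-a1.md`; builds on strategist s2's census facts A–D, `Disproof.lean`, and the two
registered negation skeletons `kelvin_sonic_negation.lean` (s1) and `mirror_point_negation.lean` (s2), re-cut.)

The crux is FIXED (by name). This file composes SIX registered stubs into `¬ SkeletonEquilibrium`:

* `stub_lengthRegular`          — s1/s2 STUB 0, shared VERBATIM: witnesses are length-regular at scales ≥ √Γ.   [L, conj.-mild]
* `stub_radialSinkModel`        — ZERO ACCRETION, MODEL FORM (PROVED by the lead, lands as a support): for the regular-singular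
  system `s h′ = (aI + K)h + (relative defect ≤ η|h|)` with `a < 0` corrected by O(η) and `K` of negative discriminant, every
  nonzero solution is unbounded at `s → 0⁺` (exact Lyapunov identity `sE′ = 2aE` for `E = −r h₁² + 2p h₁h₂ + q h₂²`). This is
  s2's fact A with `a = (3/2 − w′)/(2w′) < 0` under (SC), `K = (ΩJ + B − ½tr B)/w′`, `Ω = 2g/e²`; the defect allowance is
  UNIFORM in Ω, which is what a reduction from the nonlocal steady operator must feed it.                      [M, proved]
* `stub_zeroAccretionShadowing` — THE XL CORE, conditional on the model: (radial-sink model) → for Γ large every length-regular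
  witness with (SC) data is, filament by filament, tangent-shadowed inside the outer ball by a unit-speed solution `Yo` of the
  OUTER ODE `Yo″ = (4π/γ_k) Yo′ × (½Yo − αe₃×Yo)` that is RIPPLE-FREE to ε on the outer shell (zero accretion at the radial
  sink ⇒ no content on the trapped Kelvin-sonic chain ⇒ no branch-a gyration), every stagnation point lies in the outer unit
  ball, and — the export the endgame needs (memo §2bis) — the witness has OUTER-SCALE C² control in the R√Γ-ball around each
  stagnation point (`‖Ξ″‖ℓ ≤ M`, `‖Ξ″(τ)−Ξ″(τ′)‖ℓ ≤ M|τ−τ′|/ℓ + ε`, `ℓ = √(Γ log Γ/2)`: no core-scale k₀-content, the same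
  chain).                                                                                                          [XL, conj.]
* `stub_mirrorPointSelection`   — s2's STUB 4, shared VERBATIM: outer-ODE solutions ripple-free on a shell are θ-vertical in the
  2-ball (mirror-point law + Weber nondegeneracy of the axis; lead's independent reproduction of the Weber ripple coefficients
  in `compute/weber_axis.py`).                                                                                     [L/XL]
* `stub_strandSeparation`       — tameness near waists: returning strands of the SAME filament inside the R√Γ-ball around a
  stagnation point keep distance ≥ ρ′√Γ (force balance: induction Γγ/2πd must be carried by a drift O(ℓ + R√Γ)); isolates the
  wild-witness caveat of s1/s2 (hairpins) where it actually bites the endgame (memo §2(c)).                      [L, conj.]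
* `stub_tameVerticalSubcritical`— THE ENDGAME, reshaped from s1/s2's `stub_nearVerticalSubcritical` so that it is provable:
  strain identity `w′ = ½ + ⟪(u∘Ξ)′,T⟫` + verticality (V) + outer-scale C² control (C) + strand separation (S) + length
  regularity ⇒ `w′(τ*) ≤ ½ + C₁(θ + ε) + C₂/R² + 1/8` for Γ ≥ Γ₄ (self strand: coherent-bending cancellation gives
  `O(γ(R/log^{3/2}Γ + ε))`; other strands in the ball `O(|γ|C₀θR/min(ρ,ρ′)³)`; far field `O(Σ|γ|C₀/R²)`).          [L]

Composition `not_SkeletonEquilibrium_of` (sorry-free, below): data ⇒ C₀ ⇒ C₂ ⇒ R = 4(C₂+1) ⇒ ρ′ (separation at R) ⇒ M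
(shadowing export at R) ⇒ C₁(R, ρ′, M) ⇒ θ = ε₁ = 1/(16(C₁+1)) ⇒ (ε₀, R₁, R₃) (selection at θ/2) ⇒
ε = min(θ/2, ε₀, ε₁) ⇒ thresholds Γ₂, Γ₃, Γ₄ ⇒ evaluate the crux at Γ₀ = max(Γ₂, Γ₃, Γ₄, 2): all strands in the R√Γ-ball
around the stagnation point of filament 0 are θ-vertical (shadowing + selection + ‖(a−b)×e₃‖ ≤ ‖a−b‖), (C) and (S) hold, so
`w′(τ*) ≤ ½ + 1/16 + 1/16 + 1/16 + 1/8 < 1 < 3/2 + δ`: contradiction with (SC).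

## Disproof used
`Cruxes/SkeletonEquilibrium/Disproof.lean` (cdisprove c1): (a) (SC) is THE load-bearing clause — attacked head-on; (b) strain
identity — the endgame IS its quantitative form, and `tr B = 3/2 − w′` feeds `a < 0` in the radial-sink model; (c1)–(c3) rigid
classes (straight/vertical/planar ⇒ w′ ≡ ½) — this line is their asymptotic completion; (e2) tail law — consistent. No
`_false_without_` theorem exists; no landed Negative lemma refutes a stub.
-/

noncomputable section

open Set MeasureTheory Filter Topology
open Literature.Analysis.FluidPDE
open scoped RealInnerProductSpace InnerProductSpace BigOperators

namespace Summit.NavierStokesRegularity.NavierStokesRegularity.Cruxes.SkeletonEquilibrium.ZeroAccretionSelection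

set_option linter.unusedVariables false
set_option linter.dupNamespace false

/-- **STUB 0 (`stub_lengthRegular`; size L; conjectural, mild) — SHARED VERBATIM with the lines `kelvin-sonic-negation`
and `mirror-point-negation` (same name, same statement; one landing serves all three).** Relative equilibria of the
regularised Biot–Savart law in the rotating Leray frame satisfying the configuration clauses at `Γ ≥ 1` are
LENGTH-REGULAR at scales `≥ √Γ`: arclength inside any ball of radius `D ≥ √Γ` is `≤ C₀ D`. Why plausibly true / why it
might fail: s1's and s2's docstrings (stiffness inside the bending scale, alignment beyond; densifying solenoids violate
the integrability clause; levitating hairpins are length-regular and are NOT excluded here — they are isolated in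
`stub_strandSeparation`). [conjecture] -/
theorem stub_lengthRegular :
    ∀ (N : ℕ) (γ : Fin N → ℝ) (α ρ K : ℝ), α ≠ 0 → 0 < ρ →
      ∃ C₀ : ℝ, 0 < C₀ ∧ ∀ Γ : ℝ, 1 ≤ Γ →
        ∀ (Ξ : Fin N → ℝ → EuclideanSpace ℝ (Fin 3)) (w : Fin N → ℝ → ℝ),
          (∀ j, ContDiff ℝ 2 (Ξ j) ∧ Function.Injective (Ξ j) ∧ Differentiable ℝ (w j) ∧
              (∀ τ, ‖deriv (Ξ j) τ‖ = 1) ∧ (∀ τ, ‖iteratedDeriv 2 (Ξ j) τ‖ * Real.sqrt Γ ≤ K) ∧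
              Tendsto (fun τ => ‖Ξ j τ‖) atTop atTop ∧ Tendsto (fun τ => ‖Ξ j τ‖) atBot atTop) →
          (∀ j k, j ≠ k → ∀ τ σ, ρ * Real.sqrt Γ ≤ ‖Ξ j τ - Ξ k σ‖) →
          (∀ j (x : EuclideanSpace ℝ (Fin 3)), Integrable (fun σ : ℝ =>
              ((‖x - Ξ j σ‖ ^ 2 + 1) ^ (3 / 2 : ℝ))⁻¹ • cross (deriv (Ξ j) σ) (x - Ξ j σ))) →
          (∀ j τ, (∑ k : Fin N, (Γ * γ k / (4 * Real.pi)) • ∫ σ : ℝ,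
                ((‖Ξ j τ - Ξ k σ‖ ^ 2 + 1) ^ (3 / 2 : ℝ))⁻¹ • cross (deriv (Ξ k) σ) (Ξ j τ - Ξ k σ))
              + (1 / 2 : ℝ) • Ξ j τ - α • cross (EuclideanSpace.single (2 : Fin 3) (1 : ℝ)) (Ξ j τ)
              = w j τ • deriv (Ξ j) τ) →
          ∀ (k : Fin N) (x : EuclideanSpace ℝ (Fin 3)) (D : ℝ), Real.sqrt Γ ≤ D →
            volume {τ : ℝ | ‖Ξ k τ - x‖ ≤ D} ≤ ENNReal.ofReal (C₀ * D) := by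
  sorry

/-- **STUB 1 (`stub_radialSinkModel`; size M; PROVED and LANDED by the lead, p164748 — ZERO ACCRETION in model form).** The regular-singular
system at a stagnation point: `s h₁′ = (a+p)h₁ + q h₂ + g₁`, `s h₂′ = r h₁ + (a−p)h₂ + g₂` on `(0, s₀]` with a RELATIVE
defect `|g₁| + |g₂| ≤ η(|h₁| + |h₂|)`, `q > 0`, negative discriminant `p² + qr < 0` (complex eigenvalues `a ± ib` of
`aI + K`; for the filament `a = (3/2 − w′)/(2w′)`, `K = (ΩJ + B − ½ tr B I)/w′`, `Ω = 2g/e²` the core's solid rotation,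
so `|r|+|p|+q ≍ Ω`, `q − r ≍ 2Ω`, `−(p²+qr) ≍ Ω²` and the allowance on `η` is UNIFORM in `e`): if
`a + 2η(|r|+|p|+q)(q−r)/(−(p²+qr)) < 0` — under (SC) `a ≤ −δ/(3+2δ)` — every solution with `h(s₀) ≠ 0` is UNBOUNDED as
`s → 0⁺`. Proof (lead's `work/bricks/RadialSink.lean`, sorry-free): the quadratic form `E = −r h₁² + 2p h₁h₂ + q h₂²` is
positive definite, `sE′ ≤ 2a′E` with `a′ < 0`, so `E · s^(−2a′)` is non-increasing and `E(s) → ∞` as `s → 0⁺`. Hence a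
witness that is merely BOUNDED at its stagnation point carries no sub-core Kelvin content there, in either polarisation:
the radial-sink half of the Kelvin-sonic obstruction made kernel-checkable. [folklore] -/
theorem stub_radialSinkModel :
    ∀ (a p q r η s₀ : ℝ) (h₁ h₂ : ℝ → ℝ), p ^ 2 + q * r < 0 → 0 < q → 0 ≤ η →
      a + 2 * η * (|r| + |p| + q) * (q - r) / (-(p ^ 2 + q * r)) < 0 → 0 < s₀ →
      (∀ s, 0 < s → s ≤ s₀ → DifferentiableAt ℝ h₁ s ∧ DifferentiableAt ℝ h₂ s ∧
        |s * deriv h₁ s - (a * h₁ s + p * h₁ s + q * h₂ s)| +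
          |s * deriv h₂ s - (a * h₂ s + r * h₁ s - p * h₂ s)| ≤ η * (|h₁ s| + |h₂ s|)) →
      (h₁ s₀ ≠ 0 ∨ h₂ s₀ ≠ 0) → ∀ C : ℝ, ∃ s, 0 < s ∧ s ≤ s₀ ∧ C < h₁ s ^ 2 + h₂ s ^ 2 :=
  -- LANDED p164748 (lead a1): Theorems/FilamentSkeletonRssSkeletonEquilibriumRadialSinkModel.lean
  _root_.Summit.NavierStokesRegularity.NavierStokesRegularity.Theorems.SkeletonEquilibrium.ZeroAccretionSelection.stub_radialSinkModel

/-- **STUB 2 (`stub_zeroAccretionShadowing`; size XL; THE conjectural core, conditional on STUB 1).** Assume the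
radial-sink model. Fix the data (with the supercriticality margin `δ > 0`), a length-regularity constant `C₀` and an inner
radius parameter `R ≥ 0`; then there is an outer-curvature constant `M ≥ 0` such that for every tolerance `ε > 0` and
shell radii `0 < R₁ ≤ R₃`, for all large `Γ`, every `C₀`-length-regular configuration satisfying the clauses AND the crux's
stagnation clause satisfies, with `ℓ = √(Γ log Γ/2)` the common outer unit:
(i) SHADOWED & RIPPLE-FREE — every filament `k` is tangent-shadowed on the inner region `‖Ξ‖ ≤ ℓ + R√Γ` by a unit-speed
`C²` solution `Yo` of the outer ODE `Yo″ = (4π/γ_k) • Yo′ × (½Yo − αe₃×Yo)` (tangents matched to `ε` at points of the outer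
2-ball) whose RIPPLE FUNCTIONAL `‖T − c b − (c/β/‖B‖²) • b × Bt‖·‖Y‖` (s2; `B = ½Y − αe₃×Y`, `b = B/‖B‖`,
`Bt = ½T − αe₃×T`, `c = ⟪T,b⟫`, `β = 4π/γ_k`) is `≤ ε` at all of ITS points in the shell `R₁ ≤ ‖Yo‖ ≤ R₃`;
(ii) WAISTS INSIDE & OUTER-SCALE C² CONTROL — every stagnation point lies in the outer unit ball, `‖Ξ_j(τ*)‖ ≤ ℓ`, and in
the `R√Γ`-ball around it every strand has `‖Ξ″‖·ℓ ≤ M` and `‖Ξ″(τ) − Ξ″(τ′)‖·ℓ ≤ M|τ−τ′|/ℓ + ε`.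
Mechanism (s1 census §Negation, lead c2 memo c3 §1, s2 facts A–B): the exact Rosenhead multiplier saturates, so along every
proper end the slip outruns the bending waves; the steady characteristic chain a → fold → b → (t*, k₀/e) → B↑ → fold → B↓
ends in the radial sink of STUB 1 with `a = (3/2 − w′)/(2w′) < 0`, so a bounded witness carries NO content anywhere on the
chain: no branch-a gyration (⇒ (i): the curve is an outer-ODE trajectory with zero free gyration to O(1/log Γ)), no
k₀-content at the waist (⇒ the C² control in (ii)); waists inside the unit ball by the mirror-point law (a waist at outer
distance |Y₀| ≥ 1 radiates ripple ≈ |Y₀|). Why it might fail: the microlocal argument is formal — uniform-in-`e`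
propagation / turning-point / radial-point estimates for the NONLOCAL operator `J g m_e(D) − V∂_t + B` linearised about an
unknown witness, and the nonlinear reduction to STUB 1's normal form, are unproved (shape: Duistermaat–Hörmander + Vasy
radial estimates, doi:10.1007/s00222-012-0446-8; hydraulic analogue Trulsen–Mei doi:10.1017/s0022112093003404); wild
length-regular witnesses (hairpins) may not be shadowed by ONE trajectory. [conjecture] -/
theorem stub_zeroAccretionShadowing :
    (∀ (a p q r η s₀ : ℝ) (h₁ h₂ : ℝ → ℝ), p ^ 2 + q * r < 0 → 0 < q → 0 ≤ η →
      a + 2 * η * (|r| + |p| + q) * (q - r) / (-(p ^ 2 + q * r)) < 0 → 0 < s₀ →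
      (∀ s, 0 < s → s ≤ s₀ → DifferentiableAt ℝ h₁ s ∧ DifferentiableAt ℝ h₂ s ∧
        |s * deriv h₁ s - (a * h₁ s + p * h₁ s + q * h₂ s)| +
          |s * deriv h₂ s - (a * h₂ s + r * h₁ s - p * h₂ s)| ≤ η * (|h₁ s| + |h₂ s|)) →
      (h₁ s₀ ≠ 0 ∨ h₂ s₀ ≠ 0) → ∀ C : ℝ, ∃ s, 0 < s ∧ s ≤ s₀ ∧ C < h₁ s ^ 2 + h₂ s ^ 2) →
    ∀ (N : ℕ) (γ : Fin N → ℝ) (α δ ρ K C₀ : ℝ), α ≠ 0 → 0 < δ → 0 < ρ → 0 < C₀ → (∀ j, γ j ≠ 0) →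
      ∀ R : ℝ, 0 ≤ R → ∃ M : ℝ, 0 ≤ M ∧ ∀ ε : ℝ, 0 < ε → ∀ R₁ R₃ : ℝ, 0 < R₁ → R₁ ≤ R₃ →
      ∃ Γ₂ : ℝ, ∀ Γ : ℝ, Γ₂ ≤ Γ → 2 ≤ Γ →
        ∀ (Ξ : Fin N → ℝ → EuclideanSpace ℝ (Fin 3)) (w : Fin N → ℝ → ℝ),
          (∀ j, ContDiff ℝ 2 (Ξ j) ∧ Function.Injective (Ξ j) ∧ Differentiable ℝ (w j) ∧
              (∀ τ, ‖deriv (Ξ j) τ‖ = 1) ∧ (∀ τ, ‖iteratedDeriv 2 (Ξ j) τ‖ * Real.sqrt Γ ≤ K) ∧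
              Tendsto (fun τ => ‖Ξ j τ‖) atTop atTop ∧ Tendsto (fun τ => ‖Ξ j τ‖) atBot atTop) →
          (∀ j k, j ≠ k → ∀ τ σ, ρ * Real.sqrt Γ ≤ ‖Ξ j τ - Ξ k σ‖) →
          (∀ j (x : EuclideanSpace ℝ (Fin 3)), Integrable (fun σ : ℝ =>
              ((‖x - Ξ j σ‖ ^ 2 + 1) ^ (3 / 2 : ℝ))⁻¹ • cross (deriv (Ξ j) σ) (x - Ξ j σ))) →
          (∀ j τ, (∑ k : Fin N, (Γ * γ k / (4 * Real.pi)) • ∫ σ : ℝ,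
                ((‖Ξ j τ - Ξ k σ‖ ^ 2 + 1) ^ (3 / 2 : ℝ))⁻¹ • cross (deriv (Ξ k) σ) (Ξ j τ - Ξ k σ))
              + (1 / 2 : ℝ) • Ξ j τ - α • cross (EuclideanSpace.single (2 : Fin 3) (1 : ℝ)) (Ξ j τ)
              = w j τ • deriv (Ξ j) τ) →
          (∀ (k : Fin N) (x : EuclideanSpace ℝ (Fin 3)) (D : ℝ), Real.sqrt Γ ≤ D →
              volume {τ : ℝ | ‖Ξ k τ - x‖ ≤ D} ≤ ENNReal.ofReal (C₀ * D)) →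
          (∀ j, ∃ τs : ℝ, w j τs = 0 ∧ (∀ τ, w j τ = 0 → τ = τs) ∧ 3 / 2 + δ ≤ deriv (w j) τs) →
          (∀ k : Fin N, ∃ Yo : ℝ → EuclideanSpace ℝ (Fin 3),
            ContDiff ℝ 2 Yo ∧ (∀ s, ‖deriv Yo s‖ = 1) ∧
            (∀ s, iteratedDeriv 2 Yo s =
                (4 * Real.pi / γ k) • cross (deriv Yo s) ((1 / 2 : ℝ) • Yo s - α • cross (EuclideanSpace.single (2 : Fin 3) (1 : ℝ)) (Yo s))) ∧
            (∀ τ, ‖Ξ k τ‖ ≤ Real.sqrt (Γ * Real.log Γ / 2) + R * Real.sqrt Γ →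
                ∃ s, ‖Yo s‖ ≤ 2 ∧ ‖deriv (Ξ k) τ - deriv Yo s‖ ≤ ε) ∧
            (∀ (s : ℝ), R₁ ≤ ‖Yo s‖ → ‖Yo s‖ ≤ R₃ →
              ∀ (B b Bt : EuclideanSpace ℝ (Fin 3)) (c : ℝ), B = (1 / 2 : ℝ) • Yo s - α • cross (EuclideanSpace.single (2 : Fin 3) (1 : ℝ)) (Yo s) →
                b = ‖B‖⁻¹ • B → Bt = (1 / 2 : ℝ) • deriv Yo s - α • cross (EuclideanSpace.single (2 : Fin 3) (1 : ℝ)) (deriv Yo s) → c = ⟪deriv Yo s, b⟫ →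
                ‖deriv Yo s - c • b - (c / (4 * Real.pi / γ k) / ‖B‖ ^ 2) • cross b Bt‖ * ‖Yo s‖ ≤ ε)) ∧
          (∀ (j : Fin N) (τs : ℝ), w j τs = 0 → ‖Ξ j τs‖ ≤ Real.sqrt (Γ * Real.log Γ / 2) ∧
            (∀ (k : Fin N) (τ τ' : ℝ), ‖Ξ k τ - Ξ j τs‖ ≤ R * Real.sqrt Γ → ‖Ξ k τ' - Ξ j τs‖ ≤ R * Real.sqrt Γ →
                ‖iteratedDeriv 2 (Ξ k) τ‖ * Real.sqrt (Γ * Real.log Γ / 2) ≤ M ∧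
                ‖iteratedDeriv 2 (Ξ k) τ - iteratedDeriv 2 (Ξ k) τ'‖ * Real.sqrt (Γ * Real.log Γ / 2)
                  ≤ M * |τ - τ'| / Real.sqrt (Γ * Real.log Γ / 2) + ε)) := by
  sorry

/-- **STUB 3 (`stub_mirrorPointSelection`; size L/XL; SHARED VERBATIM with the line `mirror-point-negation`
(s2's STUB 4, same name, same statement).** Outer-ODE solutions whose ripple functional is `≤ ε₀` on a shell are
`θ`-vertical in the outer 2-ball. Content: mirror-point law (a stagnation point is where `Yo′ ⊥ A Yo`, all speed is
gyration; far waists radiate ripple ≈ |Y₀|) + NONDEGENERACY OF THE AXIS (linearisation `ζ″ + (is/2)ζ′ − (α + i/2)ζ = 0`,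
Weber equation, ripple-free-at-+∞ solution acquires ripple ∝ 1/Γ(·) ≠ 0 at −∞ for every real α ≠ 0; s2's coefficients
`|b_e|/2, |b_o|/2 = 1.58/1.41 (α = −1), 36.6/32.7 (α = +1)` independently reproduced by this lead to 1–2 %:
1.57/1.42, 36.8/32.8) + a global scan (kit j024957). Why it might fail: an isolated oblique zero of the gyration map
missed by the scan; the `∀ α ≠ 0` range needs the asymptotic regimes α → 0, ∞ handled analytically. [conjecture] -/
theorem stub_mirrorPointSelection :
    ∀ (N : ℕ) (γ : Fin N → ℝ) (α : ℝ), α ≠ 0 → (∀ k, γ k ≠ 0) →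
      ∀ θ : ℝ, 0 < θ → ∃ ε₀ R₁ R₃ : ℝ, 0 < ε₀ ∧ 0 < R₁ ∧ R₁ ≤ R₃ ∧
        ∀ (k : Fin N) (Yo : ℝ → EuclideanSpace ℝ (Fin 3)), ContDiff ℝ 2 Yo → (∀ s, ‖deriv Yo s‖ = 1) →
          (∀ s, iteratedDeriv 2 Yo s =
              (4 * Real.pi / γ k) • cross (deriv Yo s) ((1 / 2 : ℝ) • Yo s - α • cross (EuclideanSpace.single (2 : Fin 3) (1 : ℝ)) (Yo s))) →
          (∀ (s : ℝ), R₁ ≤ ‖Yo s‖ → ‖Yo s‖ ≤ R₃ →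
            ∀ (B b Bt : EuclideanSpace ℝ (Fin 3)) (c : ℝ), B = (1 / 2 : ℝ) • Yo s - α • cross (EuclideanSpace.single (2 : Fin 3) (1 : ℝ)) (Yo s) →
              b = ‖B‖⁻¹ • B → Bt = (1 / 2 : ℝ) • deriv Yo s - α • cross (EuclideanSpace.single (2 : Fin 3) (1 : ℝ)) (deriv Yo s) → c = ⟪deriv Yo s, b⟫ →
              ‖deriv Yo s - c • b - (c / (4 * Real.pi / γ k) / ‖B‖ ^ 2) • cross b Bt‖ * ‖Yo s‖ ≤ ε₀) →
          ∀ s, ‖Yo s‖ ≤ 2 → ‖cross (deriv Yo s) (EuclideanSpace.single (2 : Fin 3) (1 : ℝ))‖ ≤ θ := by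
  sorry

/-- **STUB 4 (`stub_strandSeparation`; size L; conjectural — tameness of returning strands near a waist).** For the data,
a length-regularity constant `C₀` and a radius `R ≥ 1` there are `ρ′ > 0` and `Γ₃` such that for `Γ ≥ Γ₃` every
length-regular witness with (SC) data keeps DISTINCT STRANDS OF THE SAME FILAMENT inside the `R√Γ`-ball around any
stagnation point `x₀ = Ξ_j(τ*)` at distance `≥ ρ′√Γ`, typed as a BALL-LOCAL CHORD–ARC CONDITION below the scale `ρ′√Γ`
(`ρ′ ≤ ½`): two points of filament `k` in the ball that are closer than `ρ′√Γ` in space are closer than twice that in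
parameter, `|τ − τ′| ≤ 2‖Ξ_k τ − Ξ_k τ′‖` (a single `θ`-vertical strand satisfies it with room — `|τ−τ′| ≤ ‖…‖/√(1−θ²)`;
it fails exactly for a second strand, returning from far in parameter OR after a quick U-turn outside the ball, passing
within `ρ′√Γ`). (Other filaments are `ρ√Γ`-separated by clause.) Why plausibly true: the normal force
balance at a returning strand — induction `Γγ/(2πd)` of the strand through `x₀` must be carried by the drift
`‖½y − αe₃×y‖ ≤ (½+|α|)(ℓ + R√Γ)` plus bounded self-induction — gives `d ≳ γΓ/ℓ`; with the waist in the unit ball and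
radial monotonicity of ends (`w⟪T,Ξ⟫ = ⟪u,Ξ⟫ + ½‖Ξ‖²`, lead's brick `RadialSign.lean`, and the unique-zero clause) parallel
re-entries need a drift-opposing partner, i.e. a hairpin — the one wild class nobody can exclude cheaply (s2 census §E).
Why it might fail: exactly a levitating-hairpin equilibrium. [conjecture] -/
theorem stub_strandSeparation :
    ∀ (N : ℕ) (γ : Fin N → ℝ) (α δ ρ K C₀ : ℝ), α ≠ 0 → 0 < δ → 0 < ρ → 0 < C₀ → (∀ j, γ j ≠ 0) →
      ∀ R : ℝ, 1 ≤ R → ∃ ρ' : ℝ, 0 < ρ' ∧ ρ' ≤ 1 / 2 ∧ ∃ Γ₃ : ℝ, ∀ Γ : ℝ, Γ₃ ≤ Γ → 2 ≤ Γ →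
        ∀ (Ξ : Fin N → ℝ → EuclideanSpace ℝ (Fin 3)) (w : Fin N → ℝ → ℝ),
          (∀ j, ContDiff ℝ 2 (Ξ j) ∧ Function.Injective (Ξ j) ∧ Differentiable ℝ (w j) ∧
              (∀ τ, ‖deriv (Ξ j) τ‖ = 1) ∧ (∀ τ, ‖iteratedDeriv 2 (Ξ j) τ‖ * Real.sqrt Γ ≤ K) ∧
              Tendsto (fun τ => ‖Ξ j τ‖) atTop atTop ∧ Tendsto (fun τ => ‖Ξ j τ‖) atBot atTop) →
          (∀ j k, j ≠ k → ∀ τ σ, ρ * Real.sqrt Γ ≤ ‖Ξ j τ - Ξ k σ‖) →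
          (∀ j (x : EuclideanSpace ℝ (Fin 3)), Integrable (fun σ : ℝ =>
              ((‖x - Ξ j σ‖ ^ 2 + 1) ^ (3 / 2 : ℝ))⁻¹ • cross (deriv (Ξ j) σ) (x - Ξ j σ))) →
          (∀ j τ, (∑ k : Fin N, (Γ * γ k / (4 * Real.pi)) • ∫ σ : ℝ,
                ((‖Ξ j τ - Ξ k σ‖ ^ 2 + 1) ^ (3 / 2 : ℝ))⁻¹ • cross (deriv (Ξ k) σ) (Ξ j τ - Ξ k σ))
              + (1 / 2 : ℝ) • Ξ j τ - α • cross (EuclideanSpace.single (2 : Fin 3) (1 : ℝ)) (Ξ j τ)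
              = w j τ • deriv (Ξ j) τ) →
          (∀ (k : Fin N) (x : EuclideanSpace ℝ (Fin 3)) (D : ℝ), Real.sqrt Γ ≤ D →
              volume {τ : ℝ | ‖Ξ k τ - x‖ ≤ D} ≤ ENNReal.ofReal (C₀ * D)) →
          (∀ j, ∃ τs : ℝ, w j τs = 0 ∧ (∀ τ, w j τ = 0 → τ = τs) ∧ 3 / 2 + δ ≤ deriv (w j) τs) →
          ∀ (j : Fin N) (τs : ℝ), w j τs = 0 →
            (∀ (k : Fin N) (τ τ' : ℝ), ‖Ξ k τ - Ξ j τs‖ ≤ R * Real.sqrt Γ → ‖Ξ k τ' - Ξ j τs‖ ≤ R * Real.sqrt Γ →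
                ‖Ξ k τ - Ξ k τ'‖ < ρ' * Real.sqrt Γ → |τ - τ'| ≤ 2 * ‖Ξ k τ - Ξ k τ'‖) := by
  sorry

/-- **STUB 5 (`stub_tameVerticalSubcritical`; size L; LANDED — THE ENDGAME, reshaped from s1/s2's `stub_nearVerticalSubcritical`
to be provable — lead memo §2, §2bis).** Near-vertical, TAME, length-regular configurations are SUBCRITICAL at their
stagnation points. Hypotheses at a stagnation point `x₀ = Ξ_j(τ*)` and its `R√Γ`-ball: (V) every strand in the ball is
`θ`-vertical; (C) outer-scale `C²` control `‖Ξ″‖ℓ ≤ M`, `‖Ξ″(τ) − Ξ″(τ′)‖ℓ ≤ M|τ−τ′|/ℓ + ε` (`ℓ = √(Γ log Γ/2)`);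
(S) ball-local chord–arc below `ρ′√Γ` for every filament (same-filament strand separation); length regularity. Conclusion: `w_j′(τ*) ≤ ½ + C₁(θ + ε) + C₂/R² + 1/8`
once `Γ ≥ Γ₄(θ, ε)`, with `C₂ = C₂(N, γ, ρ, K, C₀)` (far field, R-free) and `C₁ = C₁(…, R, ρ′, M)`. Proof sketch: the landed
strain identity `w′ = ½ + ⟪(u∘Ξ_j)′, Ξ_j′⟫` (`Theorems/SkeletonEquilibrium/Negative/StrainIdentity.lean`; α drops out);
differentiate the regularised Biot–Savart integral under the sign (the kernel is smooth; domination from length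
regularity); split: FAR (distance ≥ R√Γ): dyadic shells give `O(Σ|γ|C₀/R²)`; OTHER STRANDS IN THE BALL (distance
`d ≥ d₀√Γ`, `d₀ = min(ρ,ρ′)`): pointwise the axial kernel derivative of a vertical element seen from a vertical target is
`−3(…)^(-5/2)⟨r,T₀⟩det(T_k, r, T₀) = O(ψ|r|^(-3))` (relative tilt `ψ ≤ 2θ`), and the in-ball length is `≤ 2C₀R√Γ`, so this
part is `≤ (3|γ|C₀/π)·θR/d₀³` (the refined `O(θ²)` of two infinite strands is not needed); SELF STRAND: the integrand is
`(Γγ/4π)·3s(s²+1)^(-5/2)·det(T₀, a(s), −∫₀ˢa)`, `a = Ξ′ − T₀ = ∫Ξ″`, and (C) gives `|det| ≤ (5/12)M²s⁴/ℓ³ + Mεs³/ℓ²`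
on the self window `|s| < 2ρ′√Γ ≤ R√Γ` (inside the ball by unit speed; chord `≥ |s|√3/2` by (V)) — the coherent-bending
cancellation: the `Ξ″(τ*)`-parallel parts drop out —, whence
`O(γM²R/(log Γ/2)^(3/2)) + O(γMε(1 + 2log(2R)/log Γ)) ≤ 1/8 + C₁ε` for `Γ ≥ Γ₄`. Why it might fail: only through a slip in
the constants' dependence (every constant is allowed to depend on everything fixed before it). [folklore] -/
theorem stub_tameVerticalSubcritical :
    ∀ (N : ℕ) (γ : Fin N → ℝ) (α ρ K C₀ : ℝ), 0 < ρ → 0 < C₀ → ∃ C₂ : ℝ, 0 ≤ C₂ ∧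
      ∀ (R ρ' M : ℝ), 1 ≤ R → 0 < ρ' → ρ' ≤ 1 / 2 → 0 ≤ M → ∃ C₁ : ℝ, 0 ≤ C₁ ∧
      ∀ (θ ε : ℝ), 0 < θ → θ ≤ 1 / 2 → 0 < ε → ε ≤ 1 → ∃ Γ₄ : ℝ, ∀ Γ : ℝ, Γ₄ ≤ Γ → 2 ≤ Γ →
        ∀ (Ξ : Fin N → ℝ → EuclideanSpace ℝ (Fin 3)) (w : Fin N → ℝ → ℝ),
          (∀ j, ContDiff ℝ 2 (Ξ j) ∧ Function.Injective (Ξ j) ∧ Differentiable ℝ (w j) ∧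
              (∀ τ, ‖deriv (Ξ j) τ‖ = 1) ∧ (∀ τ, ‖iteratedDeriv 2 (Ξ j) τ‖ * Real.sqrt Γ ≤ K) ∧
              Tendsto (fun τ => ‖Ξ j τ‖) atTop atTop ∧ Tendsto (fun τ => ‖Ξ j τ‖) atBot atTop) →
          (∀ j k, j ≠ k → ∀ τ σ, ρ * Real.sqrt Γ ≤ ‖Ξ j τ - Ξ k σ‖) →
          (∀ j (x : EuclideanSpace ℝ (Fin 3)), Integrable (fun σ : ℝ =>
              ((‖x - Ξ j σ‖ ^ 2 + 1) ^ (3 / 2 : ℝ))⁻¹ • cross (deriv (Ξ j) σ) (x - Ξ j σ))) →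
          (∀ j τ, (∑ k : Fin N, (Γ * γ k / (4 * Real.pi)) • ∫ σ : ℝ,
                ((‖Ξ j τ - Ξ k σ‖ ^ 2 + 1) ^ (3 / 2 : ℝ))⁻¹ • cross (deriv (Ξ k) σ) (Ξ j τ - Ξ k σ))
              + (1 / 2 : ℝ) • Ξ j τ - α • cross (EuclideanSpace.single (2 : Fin 3) (1 : ℝ)) (Ξ j τ)
              = w j τ • deriv (Ξ j) τ) →
          (∀ (k : Fin N) (x : EuclideanSpace ℝ (Fin 3)) (D : ℝ), Real.sqrt Γ ≤ D →
              volume {τ : ℝ | ‖Ξ k τ - x‖ ≤ D} ≤ ENNReal.ofReal (C₀ * D)) →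
          ∀ (j : Fin N) (τs : ℝ), w j τs = 0 →
            (∀ (k : Fin N) (τ : ℝ), ‖Ξ k τ - Ξ j τs‖ ≤ R * Real.sqrt Γ →
                ‖cross (deriv (Ξ k) τ) (EuclideanSpace.single (2 : Fin 3) (1 : ℝ))‖ ≤ θ) →
            (∀ (k : Fin N) (τ τ' : ℝ), ‖Ξ k τ - Ξ j τs‖ ≤ R * Real.sqrt Γ → ‖Ξ k τ' - Ξ j τs‖ ≤ R * Real.sqrt Γ →
                ‖iteratedDeriv 2 (Ξ k) τ‖ * Real.sqrt (Γ * Real.log Γ / 2) ≤ M ∧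
                ‖iteratedDeriv 2 (Ξ k) τ - iteratedDeriv 2 (Ξ k) τ'‖ * Real.sqrt (Γ * Real.log Γ / 2)
                  ≤ M * |τ - τ'| / Real.sqrt (Γ * Real.log Γ / 2) + ε) →
            (∀ (k : Fin N) (τ τ' : ℝ), ‖Ξ k τ - Ξ j τs‖ ≤ R * Real.sqrt Γ → ‖Ξ k τ' - Ξ j τs‖ ≤ R * Real.sqrt Γ →
                ‖Ξ k τ - Ξ k τ'‖ < ρ' * Real.sqrt Γ → |τ - τ'| ≤ 2 * ‖Ξ k τ - Ξ k τ'‖) →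
            deriv (w j) τs ≤ 1 / 2 + C₁ * (θ + ε) + C₂ / R ^ 2 + 1 / 8 :=
  -- LANDED (lead a1, cycle 1): Theorems/FilamentSkeletonRssSkeletonEquilibriumTameVerticalSubcritical.lean
  _root_.Summit.NavierStokesRegularity.NavierStokesRegularity.Theorems.SkeletonEquilibrium.ZeroAccretionSelection.stub_tameVerticalSubcritical

/-! ## Tools stub (registered; not part of the composition — it serves the proof of STUB 5 and every negation line) -/

/-- **TOOLS STUB (`stub_slopeFormula`; size M/L; LANDED p165350).** THE QUANTITATIVE STRAIN IDENTITY. For a configuration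
satisfying the per-filament clauses, the integrability clause, the relative-equilibrium system and length regularity at
scales `≥ √Γ` (`Γ ≥ 1`), the slip derivative of every filament at every parameter is given by differentiating the
regularised Biot–Savart integral UNDER the integral sign along the filament:
`w_j′(τ) = ½ + Σ_k (Γγ_k/4π) ∫ (−3)((‖r‖²+1)^(5/2))⁻¹ ⟪r, T_j⟫ ⟪T_k(σ) × r, T_j⟫ dσ`, `r = Ξ_j(τ) − Ξ_k(σ)`,
`T_j = Ξ_j′(τ)`, with the scalar integrand Bochner-integrable for every `k` (the `T_k × T_j` term of the derivative is
orthogonal to `T_j` and drops out). Ingredients: the landed `witness_slope_eq`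
(`Theorems/SkeletonEquilibrium/Negative/StrainIdentity.lean`: `w′ = ½ + ⟪F′, T⟫` with `F` the induced velocity along
the filament, differentiable by the equation itself); `hasFDerivAt_integral_of_dominated_of_fderiv_le` with the dominating
function `σ ↦ 4·5^(3/2)·((‖Ξ_j τ − Ξ_k σ‖² + 1)^(3/2))⁻¹` on the unit ball around `Ξ_j(τ)`, integrable by length
regularity (measure of `{σ : ‖Ξ_k σ − x‖ ≤ D} ≤ C₀D` for `D ≥ √Γ`, dyadic shells); the pointwise derivative
`D_x[((‖x−y‖²+1)^(3/2))⁻¹ • T × (x − y)]·v = −3((‖x−y‖²+1)^(5/2))⁻¹⟪x−y, v⟫ • T × (x−y) + ((‖x−y‖²+1)^(3/2))⁻¹ • T × v`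
(cf. the landed `stub_biotSavartDirectionalDeriv`, p136890, same kernel with core `e`). Why it might fail: only by a slip
in the formula (sign −3, power 5/2, order of the cross product as in the clause). [folklore] -/
theorem stub_slopeFormula :
    ∀ (N : ℕ) (γ : Fin N → ℝ) (α Γ K C₀ : ℝ), 1 ≤ Γ → 0 < C₀ →
      ∀ (Ξ : Fin N → ℝ → EuclideanSpace ℝ (Fin 3)) (w : Fin N → ℝ → ℝ),
        (∀ j, ContDiff ℝ 2 (Ξ j) ∧ Function.Injective (Ξ j) ∧ Differentiable ℝ (w j) ∧
            (∀ τ, ‖deriv (Ξ j) τ‖ = 1) ∧ (∀ τ, ‖iteratedDeriv 2 (Ξ j) τ‖ * Real.sqrt Γ ≤ K) ∧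
            Tendsto (fun τ => ‖Ξ j τ‖) atTop atTop ∧ Tendsto (fun τ => ‖Ξ j τ‖) atBot atTop) →
        (∀ j (x : EuclideanSpace ℝ (Fin 3)), Integrable (fun σ : ℝ =>
            ((‖x - Ξ j σ‖ ^ 2 + 1) ^ (3 / 2 : ℝ))⁻¹ • cross (deriv (Ξ j) σ) (x - Ξ j σ))) →
        (∀ j τ, (∑ k : Fin N, (Γ * γ k / (4 * Real.pi)) • ∫ σ : ℝ,
              ((‖Ξ j τ - Ξ k σ‖ ^ 2 + 1) ^ (3 / 2 : ℝ))⁻¹ • cross (deriv (Ξ k) σ) (Ξ j τ - Ξ k σ))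
            + (1 / 2 : ℝ) • Ξ j τ - α • cross (EuclideanSpace.single (2 : Fin 3) (1 : ℝ)) (Ξ j τ)
            = w j τ • deriv (Ξ j) τ) →
        (∀ (k : Fin N) (x : EuclideanSpace ℝ (Fin 3)) (D : ℝ), Real.sqrt Γ ≤ D →
            volume {τ : ℝ | ‖Ξ k τ - x‖ ≤ D} ≤ ENNReal.ofReal (C₀ * D)) →
        ∀ (j : Fin N) (τ : ℝ),
          (∀ k : Fin N, Integrable (fun σ : ℝ =>
            (-3) * ((‖Ξ j τ - Ξ k σ‖ ^ 2 + 1) ^ (5 / 2 : ℝ))⁻¹ * ⟪Ξ j τ - Ξ k σ, deriv (Ξ j) τ⟫ *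
              ⟪cross (deriv (Ξ k) σ) (Ξ j τ - Ξ k σ), deriv (Ξ j) τ⟫)) ∧
          deriv (w j) τ = 1 / 2 + ∑ k : Fin N, (Γ * γ k / (4 * Real.pi)) * ∫ σ : ℝ,
            (-3) * ((‖Ξ j τ - Ξ k σ‖ ^ 2 + 1) ^ (5 / 2 : ℝ))⁻¹ * ⟪Ξ j τ - Ξ k σ, deriv (Ξ j) τ⟫ *
              ⟪cross (deriv (Ξ k) σ) (Ξ j τ - Ξ k σ), deriv (Ξ j) τ⟫ :=
  -- LANDED p165350 (wave 2 worker): Theorems/FilamentSkeletonRssSkeletonEquilibriumSlopeFormula.lean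
  _root_.Summit.NavierStokesRegularity.NavierStokesRegularity.Theorems.SkeletonEquilibrium.ZeroAccretionSelection.stub_slopeFormula

/-! ## Two elementary facts about the cross product used by the composition (sorry-free) -/

/-- `‖v × w‖ ≤ ‖v‖ ‖w‖` (from the Literature identity `norm_cross`). -/
theorem norm_cross_le (v w : EuclideanSpace ℝ (Fin 3)) : ‖cross v w‖ ≤ ‖v‖ * ‖w‖ := by
  rw [norm_cross]
  have h1 : Real.sin (InnerProductGeometry.angle v w) ≤ 1 := Real.sin_le_one _
  have h2 : 0 ≤ ‖v‖ * ‖w‖ := by positivity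
  nlinarith

/-- `(v − v′) × w = v × w − v′ × w` (bilinearity, via the bundled `crossCLM`). -/
theorem cross_sub_left (v v' w : EuclideanSpace ℝ (Fin 3)) : cross (v - v') w = cross v w - cross v' w := by
  rw [← crossCLM_apply, ← crossCLM_apply, ← crossCLM_apply]
  exact crossCLM.map_sub₂ v v' w

/-- `‖e₃‖ = 1`. -/
theorem norm_e3 : ‖(EuclideanSpace.single (2 : Fin 3) (1 : ℝ))‖ = 1 := by
  simp

/-! ## Composition -/

/-- **The negation skeleton theorem (line `zero-accretion-selection`)**: the six stubs compose to
`¬ SkeletonEquilibrium` (sorry-free). -/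
theorem not_SkeletonEquilibrium_of :
    ¬ Theses.FilamentSkeletonRss.SkeletonEquilibrium := by
  intro h
  obtain ⟨N, γ, α, δ, ρ, K, hN, hα, hδ, hρ, hγ, hfam⟩ := h
  -- length-regularity constant of the data (STUB 0)
  obtain ⟨C₀, hC₀, hreg⟩ := stub_lengthRegular N γ α ρ K hα hρ
  -- far-field endgame constant (STUB 5, first layer) and the ball radius R
  obtain ⟨C₂, hC₂, hsub₂⟩ := stub_tameVerticalSubcritical N γ α ρ K C₀ hρ hC₀
  set R : ℝ := 4 * (C₂ + 1) with hR_def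
  have hC₂1 : 0 < C₂ + 1 := by linarith
  have hR : 1 ≤ R := by rw [hR_def]; linarith
  have hR0 : 0 ≤ R := by linarith
  have hRkey : C₂ / R ^ 2 ≤ 1 / 16 := by
    rw [hR_def, div_le_iff₀ (by positivity)]
    nlinarith
  -- strand separation at radius R (STUB 4)
  obtain ⟨ρ', hρ', hρ'h, Γ₃, hsep⟩ := stub_strandSeparation N γ α δ ρ K C₀ hα hδ hρ hC₀ hγ R hR
  -- outer-curvature export constant M at radius R (STUB 2, first layer, fed with STUB 1)
  obtain ⟨M, hM, hshadow⟩ :=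
    stub_zeroAccretionShadowing stub_radialSinkModel N γ α δ ρ K C₀ hα hδ hρ hC₀ hγ R hR0
  -- near-field endgame constant (STUB 5, second layer) and the tolerances θ = ε₁
  obtain ⟨C₁, hC₁, hsub⟩ := hsub₂ R ρ' M hR hρ' hρ'h hM
  have hC₁1 : 0 < C₁ + 1 := by linarith
  set θ : ℝ := 1 / (16 * (C₁ + 1)) with hθ_def
  set ε₁ : ℝ := 1 / (16 * (C₁ + 1)) with hε₁_def
  have hθ : 0 < θ := by rw [hθ_def]; positivity
  have hθhalf : θ ≤ 1 / 2 := by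
    rw [hθ_def, div_le_div_iff₀ (by positivity) (by norm_num)]; nlinarith
  have hε₁ : 0 < ε₁ := by rw [hε₁_def]; positivity
  have hθkey : C₁ * θ ≤ 1 / 16 := by
    rw [hθ_def, mul_one_div, div_le_div_iff₀ (by positivity) (by norm_num)]; nlinarith
  have hε₁key : C₁ * ε₁ ≤ 1 / 16 := by
    rw [hε₁_def, mul_one_div, div_le_div_iff₀ (by positivity) (by norm_num)]; nlinarith
  -- selection constants at tolerance θ/2 (STUB 3)
  obtain ⟨ε₀, R₁, R₃, hε₀, hR₁, hR₁₃, hsel⟩ :=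
    stub_mirrorPointSelection N γ α hα hγ (θ / 2) (by positivity)
  -- the working tolerance
  set ε : ℝ := min (θ / 2) (min ε₀ ε₁) with hε_def
  have hε : 0 < ε := by rw [hε_def]; exact lt_min (by positivity) (lt_min hε₀ hε₁)
  have hεθ : ε ≤ θ / 2 := min_le_left _ _
  have hεε₀ : ε ≤ ε₀ := le_trans (min_le_right _ _) (min_le_left _ _)
  have hεε₁ : ε ≤ ε₁ := le_trans (min_le_right _ _) (min_le_right _ _)
  have hε1 : ε ≤ 1 := by
    have : ε₁ ≤ 1 := by
      rw [hε₁_def, div_le_one (by positivity)]; nlinarith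
    linarith
  -- thresholds (STUBS 2, 5)
  obtain ⟨Γ₂, hshad⟩ := hshadow ε hε R₁ R₃ hR₁ hR₁₃
  obtain ⟨Γ₄, hend⟩ := hsub θ ε hθ hθhalf hε hε1
  -- evaluate the crux at Γ₀ = max (max Γ₂ Γ₃) (max Γ₄ 2)
  obtain ⟨Γ, hΓ₀, hΓpos, Ξ, w, h1, h2, h3, h4, h5⟩ := hfam (max (max Γ₂ Γ₃) (max Γ₄ 2))
  have hΓ₂ : Γ₂ ≤ Γ := le_trans (le_trans (le_max_left _ _) (le_max_left _ _)) hΓ₀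
  have hΓ₃ : Γ₃ ≤ Γ := le_trans (le_trans (le_max_right _ _) (le_max_left _ _)) hΓ₀
  have hΓ₄ : Γ₄ ≤ Γ := le_trans (le_trans (le_max_left _ _) (le_max_right _ _)) hΓ₀
  have hΓ2 : 2 ≤ Γ := le_trans (le_trans (le_max_right _ _) (le_max_right _ _)) hΓ₀
  have hΓ1 : 1 ≤ Γ := by linarith
  -- length regularity at this Γ
  have hL := hreg Γ hΓ1 Ξ w h1 h2 h3 h4
  -- shadowing/ripple-free/waist/C²-control (STUB 2) and separation (STUB 4) at this Γ
  obtain ⟨hYo, hwaist⟩ := hshad Γ hΓ₂ hΓ2 Ξ w h1 h2 h3 h4 hL h5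
  have hS := hsep Γ hΓ₃ hΓ2 Ξ w h1 h2 h3 h4 hL h5
  -- a filament and its stagnation point
  set j : Fin N := ⟨0, hN⟩ with hj
  obtain ⟨τs, hz, huniq, hsc⟩ := h5 j
  obtain ⟨hwj, hctrl⟩ := hwaist j τs hz
  -- VERTICALITY of every strand within R√Γ of the stagnation point
  have hvert : ∀ (k : Fin N) (τ : ℝ), ‖Ξ k τ - Ξ j τs‖ ≤ R * Real.sqrt Γ →
      ‖cross (deriv (Ξ k) τ) (EuclideanSpace.single (2 : Fin 3) (1 : ℝ))‖ ≤ θ := by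
    intro k τ hkτ
    obtain ⟨Yo, hYo1, hYo2, hYo3, hYoa, hYob⟩ := hYo k
    -- the shadowing solution is ripple ≤ ε ≤ ε₀ on the shell
    have hYo_rip : ∀ (s : ℝ), R₁ ≤ ‖Yo s‖ → ‖Yo s‖ ≤ R₃ →
        ∀ (B b Bt : EuclideanSpace ℝ (Fin 3)) (c : ℝ), B = (1 / 2 : ℝ) • Yo s - α • cross (EuclideanSpace.single (2 : Fin 3) (1 : ℝ)) (Yo s) →
          b = ‖B‖⁻¹ • B → Bt = (1 / 2 : ℝ) • deriv Yo s - α • cross (EuclideanSpace.single (2 : Fin 3) (1 : ℝ)) (deriv Yo s) → c = ⟪deriv Yo s, b⟫ →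
          ‖deriv Yo s - c • b - (c / (4 * Real.pi / γ k) / ‖B‖ ^ 2) • cross b Bt‖ * ‖Yo s‖ ≤ ε₀ := by
      intro s hs1 hs3 B b Bt c hB hb hBt hc
      exact le_trans (hYob s hs1 hs3 B b Bt c hB hb hBt hc) hεε₀
    -- hence θ/2-vertical on the outer 2-ball (STUB 3)
    have hYo_vert := hsel k Yo hYo1 hYo2 hYo3 hYo_rip
    -- the strand point lies in the inner region ‖Ξ‖ ≤ ℓ + R√Γ
    have hin : ‖Ξ k τ‖ ≤ Real.sqrt (Γ * Real.log Γ / 2) + R * Real.sqrt Γ := by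
      have h' : ‖Ξ k τ‖ ≤ ‖Ξ j τs‖ + ‖Ξ k τ - Ξ j τs‖ := by
        have := norm_add_le (Ξ j τs) (Ξ k τ - Ξ j τs)
        simpa using this
      linarith
    obtain ⟨s, hs2, hts⟩ := hYoa τ hin
    have hv := hYo_vert s hs2
    -- transfer verticality from Yo′(s) to Ξ_k′(τ)
    calc ‖cross (deriv (Ξ k) τ) (EuclideanSpace.single (2 : Fin 3) (1 : ℝ))‖
        = ‖cross (deriv Yo s) (EuclideanSpace.single (2 : Fin 3) (1 : ℝ)) + cross (deriv (Ξ k) τ - deriv Yo s) (EuclideanSpace.single (2 : Fin 3) (1 : ℝ))‖ := by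
          rw [cross_sub_left]; congr 1; abel
      _ ≤ ‖cross (deriv Yo s) (EuclideanSpace.single (2 : Fin 3) (1 : ℝ))‖ + ‖cross (deriv (Ξ k) τ - deriv Yo s) (EuclideanSpace.single (2 : Fin 3) (1 : ℝ))‖ := norm_add_le _ _
      _ ≤ θ / 2 + ‖deriv (Ξ k) τ - deriv Yo s‖ * ‖(EuclideanSpace.single (2 : Fin 3) (1 : ℝ))‖ := add_le_add hv (norm_cross_le _ _)
      _ ≤ θ / 2 + ε := by rw [norm_e3, mul_one]; linarith
      _ ≤ θ := by linarith
  -- subcriticality (STUB 5)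
  have hw := hend Γ hΓ₄ hΓ2 Ξ w h1 h2 h3 h4 hL j τs hz hvert hctrl (hS j τs hz)
  -- the chosen tolerances give C₁(θ² + ε) + C₂/R² + 1/8 ≤ 5/16
  have hkey : C₁ * (θ + ε) ≤ 1 / 8 := by
    have : C₁ * ε ≤ C₁ * ε₁ := mul_le_mul_of_nonneg_left hεε₁ hC₁
    nlinarith
  -- contradiction with (SC): 3/2 + δ ≤ w′(τ*) ≤ 1/2 + 1/8 + 1/16 + 1/8
  linarith

end Summit.NavierStokesRegularity.NavierStokesRegularity.Cruxes.SkeletonEquilibrium.ZeroAccretionSelection
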